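import Literature.MathematicalPhysics.QuantumFieldTheory.Balaban1983to89.B6Lemma24TopTorusV1
import Literature.MathematicalPhysics.QuantumFieldTheory.Balaban1983to89.B6Ineq2118LowerMultiLevelV1

/-!
# `Balaban1983to89.B6Ineq2153MultiLevelV1` — T. Bałaban, *Propagators and renormalization transformations for lattice gauge theories. II*,
# Commun. Math. Phys. **96** (1984) 223–250 [Balaban1984PropagatorsII], (2.153) p. 249: **`⟨B, Δ_kB⟩ ≥ (γ₀∕12d²)L^{−d−1}‖B‖²` ON THE SUBSPACE «`QB = 0`,
# `B(Γ_{y,x}) = 0`» FOR THE MULTI-LEVEL V1 OPERATOR `Δ_k = (QGQ*)⁻¹ − a` OF EVERY NESTED FAMILY `{Λ_j}`, with `γ₀ = 1`** — the assembly of the position-space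
# lower (2.118) (`B6Ineq2118LowerMultiLevelV1`) with Lemma 2.4 on the top torus (`B6Lemma24TopTorusV1`); in `L²(𝔅)` currency, in real-bond-FUNCTION currency
# (the scalar row NODE 00's lift consumes), and in print's units (`c = Lᵏ = η⁻¹`: constant `η^{−(d+1)}·(1∕(12d²))·L^{−(d+1)}`, `k`-free after `η^{d+1}`)

statement-level skeleton of published theorems with citation tags; proofs where landed; nothing here is a claim about the Yang–Mills mass gap.

THE PRINT (verbatim).  p. 249: *«Next let us consider the inequality (2.128) in Lemma 2.4 again. We will apply it in the following situation. Doing a k + 1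
renormalization transformation we have to calculate an integral of the form const ∫dB δ(QB)δ_{Ax}(B) e^{−½⟨B,Δ_kB⟩}F(B) (2.152) on the whole lattice T^{(k)}, or
on a subset Λ ⊂ T^{(k)}. Using (2.118) and (2.128) we get ⟨B, Δ_kB⟩ ≥ (γ₀∕12d²)L^{−d−1}‖B‖², or Δ_k ≥ (γ₀∕12d²)L^{−d−1} (2.153) on the subspace of B
satisfying: QB = 0, B(Γ_{y,x}) = 0 for x ∈ B(y).»*  [Balaban1985BackgroundPropagators] p. 428: *«a positive definite operator C*Δ_kC with a lower bound γ₀ > 0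
independent of k and U. We have proved it in [4], Lemma 2.4, for operators with U = 1.»*

WHY THIS FILE (cell `pub-ymgap`, D-0062; seat dag-n08-b gen 36, CLAIM-16; node N06 G-B9-09 at `U = 1` ∕ node N08 row `h324c`; node00-def-Y LOCATED-D153).
The two companions give, for the GENUINE multi-level operator of p21's `B6SectAVectorModelV1` (the one whose lift is NODE 00's `(QG₁Q*)⁻¹(1)`,
n06-i `QGQinvY_one_liftEndY`): `c²·(L^d∕L²)^k·Σ_{P⊂T^{(k)}}(∂B̂)(P)² ≤ ⟨B,(QGQ*)⁻¹B⟩ − Σ_𝔅 w·B²` (A) and `(1∕(12d²))·(L^{d+1})⁻¹·Σ_b B̂(b)² ≤ L^{d−2}Σ_c(Q₁B̂)(c)²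
+ Σ_P(∂B̂)(P)²` (B).  THIS FILE composes them on print's subspace — `Q₁B̂ = 0` at EVERY coarse bond (the STAR set «c ∈ Λ′» of [4] (2.3) p.224 ∕ Lemma 2.4
p.245; with Dirichlet data outside `st(Λ)` the bonds joining two non-`Λ′` blocks are automatic — cf. this seat's CHECK-L, pub-ymgap bus 2026-08-29: with
both-end-good constraints only, coarse pure gauges survive and no `γ₀ > 0` exists at slab members) and the tree gauge — to [4] (2.153) for every nested
family, and restates it (i) for real bond FUNCTIONS `g : 𝔅 → ℝ` (the binder of dag-n08-d's `…Ineq2153ScalarReductionAtNode00.ineq2153_one_of_scalarRow_on ∕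
_star`, whose `onFun (EE …) g q` is this file's `EE … (WithLp.toLp 2 g) q` by `rfl`), and (ii) in print's units.  Nothing of (A)∕(B)∕p21∕pv09 restated.

WHAT IS PROVED (0 `sorry`, 0 `def`, standard axioms; `D : Domains P`, `k = D.k`, `c ≠ 0`, `w > 0`, `d ≥ 2`).
* §1 `sum_sq_eq_sum_sq_top`, `normSq_eq_sum_sq_top`: for `B ∈ L²(𝔅)` vanishing on the index bonds of level `< k` and `B̂` its top reading extended by zero,
  `‖B‖² = Σ_{b : T^{(k)}-bonds} B̂(b)²`.
* §2 ★★★ `ineq2153_multiLevel` — tree gauge on every `L`-block of `T^{(k)}` (pv09's shape, read through `zcast`) and `(Q₁B̂)(c) = 0` for every `c ∈ T′ × {μ}`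
  (label currency, hypothesis `L ∣ sitesPerDir k`): **`c²·(L^d∕L²)^k·(1∕(12d²))·(L^{d+1})⁻¹·‖B‖² ≤ ⟨B,(QGQ*)⁻¹B⟩ − Σ_𝔅 w·B²`**;
  ★★★ `ineq2153_multiLevel_bondAvg` — LOCAL tree form (gauged on the blocks of `S ⊂ T^{(k+1)}`, vanishing inside the others) and `(QB̂)(c) = 0` for every
  `c : PBond P (k+1)` (`k + 1 ≤ m + K`).
* §3 `inner_EE_toLp_eq_sum`; ★★★ `ineq2153_multiLevel_fun` ∕ `ineq2153_multiLevel_fun_bondAvg` — the same for `g : 𝔅 → ℝ`: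
  `γ·Σ_q g(q)² ≤ Σ_q g(q)·(((QGQ*)⁻¹g)(q) − w(q)g(q))`.
* §4 `const_eq_of_cf`; ★★★ `ineq2153_multiLevel_fun_printUnits` — at `c = Lᵏ`: `(1∕(12d²))·(L^{d+1})⁻¹·Σ g² ≤ (L^{kd})⁻¹·Σ_q g·((QGQ*)⁻¹g − w·g)`
  (`(L^{kd})⁻¹ = η^{d}` here is def-Y's `etaDY` for the `(d−1)+1`-dimensional NODE 00 torus: the member-uniform `γ₀ = (1∕(12d²))·L^{−(d+1)}` of (2.153) with
  Jensen's `γ₀ = 1`, `d` = the torus dimension `P.d`).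

HONEST SCOPE.  Composition of the two companions; `U = 1`; V1 flat units made explicit; the hypotheses are print's (2.153) subspace in the STAR reading; the
member-level keying (def-Y's `inΛY ∕ IsAxialY ∕ Q1Y … 1 ∕ IsCornerY ∕ GoodY` ↦ these binders) is the companion `…PrecisionDoorGamma0AtOne` ∕ dag-n08-d's lift,
not here.  Nothing about `U ≠ 1`, the continuum, OS or the mass gap; count-neutral; node N06 ∕ N08 NOT discharged.
-/

open scoped InnerProductSpace

namespace Literature.MathematicalPhysics.QuantumFieldTheory.Balaban1983to89.B6Ineq2153MultiLevelV1

open LatticeFieldCalculus B6SectADomainsV1 B6SectAOperatorsV1 B6SectAVectorModelV1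
open BalabanImbrieJaffe1984to88.BIJ85AxialPropagator411 (BondSpace PlaqSpace)
open B6Lemma24Torus (coarseSites faces pbox)
open B6BondElimination (treeBonds)
open B6SectADeltaACoerciveReductionV1 (normSq_eq_sum_sq)
open B6Lemma24TopTorusV1 (zcast zlift cornerLab periodAt lemma24_topTorus_of_q1_zero lemma24_topTorus lemma24_topTorus_local)
open B6Ineq2118LowerMultiLevelV1 (ineq2118_lower_multiLevel)
open Finset

noncomputable section

variable {P : Params} (D : Domains P)

/-! ## §1 The norm of a top-level `B` is the norm of its top reading -/

/-- for `B ∈ L²(𝔅)` vanishing below the top level, `Σ_𝔅 B² = Σ_{b⊂T^{(k)}} B̂(b)²` (`B̂` the top reading extended by zero; the index bonds of level `k`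
inject into the bonds of `T^{(k)}`). [cite: Balaban1984PropagatorsII, (2.3) p.224, (2.152)–(2.153) p.249, bookkeeping] -/
theorem sum_sq_eq_sum_sq_top (B : BondIdxSpace D) (hB : ∀ i : BondIdx D, (i.1.1 : ℕ) < D.k → B i = 0) (Bk : PBond P D.k → ℝ)
    (hBk : ∀ (b : PBond P D.k) (h : D.LamBond D.k b), Bk b = B ⟨⟨Fin.last D.k, b⟩, h⟩)
    (hBk0 : ∀ b : PBond P D.k, ¬ D.LamBond D.k b → Bk b = 0) :
    ∑ i : BondIdx D, B i ^ 2 = ∑ b : PBond P D.k, Bk b ^ 2 := by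
  classical
  -- read the subtype sum as a sum over the sigma type with an indicator
  set F : ((j : Fin (D.k + 1)) × PBond P (j : ℕ)) → ℝ := fun p => if h : D.LamBond p.1 p.2 then B ⟨p, h⟩ ^ 2 else 0 with hF
  have h1 : ∑ i : BondIdx D, B i ^ 2 = ∑ i : BondIdx D, F i.1 := Finset.sum_congr rfl fun i _ => by rw [hF]; simp only [dif_pos i.2]
  have h2 : ∑ i : BondIdx D, F i.1 = ∑ p : (j : Fin (D.k + 1)) × PBond P (j : ℕ), F p := by
    rw [← Finset.sum_subtype (Finset.univ.filter fun p : (j : Fin (D.k + 1)) × PBond P (j : ℕ) => D.LamBond p.1 p.2)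
      (fun p => by simp) F, Finset.sum_filter]
    refine Finset.sum_congr rfl fun p _ => ?_
    by_cases h : D.LamBond p.1 p.2
    · rw [if_pos h]
    · rw [if_neg h, hF]; simp only [dif_neg h]
  rw [h1, h2, Fintype.sum_sigma, Finset.sum_eq_single (Fin.last D.k)]
  · refine Finset.sum_congr rfl fun b _ => ?_
    by_cases h : D.LamBond D.k b
    · simp only [hF, Fin.val_last, dif_pos h, hBk b h]
    · simp only [hF, Fin.val_last, dif_neg h, hBk0 b h]; ring
  · intro j _ hj
    refine Finset.sum_eq_zero fun b _ => ?_
    simp only [hF]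
    by_cases h : D.LamBond j b
    · have hjlt : ((j : ℕ)) < D.k := lt_of_le_of_ne (Nat.lt_succ_iff.mp j.2) fun e => hj (Fin.ext (by rw [Fin.val_last]; exact e))
      rw [dif_pos h, hB ⟨⟨j, b⟩, h⟩ hjlt, zero_pow two_ne_zero]
    · rw [dif_neg h]
  · intro h; exact absurd (Finset.mem_univ _) h

/-- `‖B‖² = Σ_{b⊂T^{(k)}} B̂(b)²`. [cite: Balaban1984PropagatorsII, (2.153) p.249, bookkeeping] -/
theorem normSq_eq_sum_sq_top (B : BondIdxSpace D) (hB : ∀ i : BondIdx D, (i.1.1 : ℕ) < D.k → B i = 0) (Bk : PBond P D.k → ℝ)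
    (hBk : ∀ (b : PBond P D.k) (h : D.LamBond D.k b), Bk b = B ⟨⟨Fin.last D.k, b⟩, h⟩)
    (hBk0 : ∀ b : PBond P D.k, ¬ D.LamBond D.k b → Bk b = 0) :
    ‖B‖ ^ 2 = ∑ b : PBond P D.k, Bk b ^ 2 := by
  rw [normSq_eq_sum_sq, sum_sq_eq_sum_sq_top D B hB Bk hBk hBk0]

/-! ## §2 ★★★ (2.153) for the multi-level operator on `L²(𝔅)` -/

/-- ★★★ **[4] (2.153) FOR THE MULTI-LEVEL `Δ_k = (QGQ*)⁻¹ − a` (γ₀ = 1)**: for every nested family `{Λ_j}`, `d ≥ 2`, `L ∣ sitesPerDir k`, `c ≠ 0`, `w > 0`,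
every `B ∈ L²(𝔅)` vanishing below level `k` whose top reading `B̂` is in the axial gauge of every `L`-block of `T^{(k)}` ((2.121), pv09's shape through
`zcast`) and satisfies `(Q₁B̂)(c) = 0` at EVERY coarse bond (print's «QB = 0», STAR set):
`c²·(L^d∕L²)^k·(1∕(12d²))·(L^{d+1})⁻¹·‖B‖² ≤ ⟨B,(QGQ*)⁻¹B⟩ − Σ_𝔅 w·B²`.
[cite: Balaban1984PropagatorsII, (2.153) p.249, (2.118) p.243, Lemma 2.4 (2.128) p.245; Balaban1985BackgroundPropagators, (3.156) p.428] -/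
theorem ineq2153_multiLevel (hd : 2 ≤ P.d) (hLM : P.L ∣ P.sitesPerDir D.k) {c : ℝ} (hc : c ≠ 0) {w : BondIdx D → ℝ} (hw : ∀ i, 0 < w i)
    (B : BondIdxSpace D) (hB : ∀ i : BondIdx D, (i.1.1 : ℕ) < D.k → B i = 0) (Bk : PBond P D.k → ℝ)
    (hBk : ∀ (b : PBond P D.k) (h : D.LamBond D.k b), Bk b = B ⟨⟨Fin.last D.k, b⟩, h⟩)
    (hBk0 : ∀ b : PBond P D.k, ¬ D.LamBond D.k b → Bk b = 0)
    (hT : ∀ y ∈ coarseSites P.L (periodAt P D.k), ∀ b ∈ treeBonds P.L y, Bk ⟨zcast D.k b.1, b.2⟩ = 0)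
    (hQ : ∀ c' ∈ faces P.L (periodAt P D.k), B6Lemma24PrintedShape.q1 P.L (zlift Bk) c' = 0) :
    c ^ 2 * ((P.L : ℝ) ^ P.d * ((P.L : ℝ) ^ 2)⁻¹) ^ D.k * (1 / (12 * (P.d : ℝ) ^ 2) * ((P.L : ℝ) ^ (P.d + 1))⁻¹) * ‖B‖ ^ 2 ≤
      ⟪B, EE D hc hw B⟫_ℝ - ∑ i, w i * B i ^ 2 := by
  have hA := ineq2118_lower_multiLevel D hc hw B hB Bk hBk hBk0
  have hL24 := lemma24_topTorus_of_q1_zero hd hLM Bk hT hQ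
  have hL : (0 : ℝ) < P.L := Nat.cast_pos.mpr P.L_pos
  rw [normSq_eq_sum_sq_top D B hB Bk hBk hBk0]
  calc c ^ 2 * ((P.L : ℝ) ^ P.d * ((P.L : ℝ) ^ 2)⁻¹) ^ D.k * (1 / (12 * (P.d : ℝ) ^ 2) * ((P.L : ℝ) ^ (P.d + 1))⁻¹) *
        ∑ b : PBond P D.k, Bk b ^ 2
      = c ^ 2 * ((P.L : ℝ) ^ P.d * ((P.L : ℝ) ^ 2)⁻¹) ^ D.k *
          (1 / (12 * (P.d : ℝ) ^ 2) * ((P.L : ℝ) ^ (P.d + 1))⁻¹ * ∑ b : PBond P D.k, Bk b ^ 2) := by ring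
    _ ≤ c ^ 2 * ((P.L : ℝ) ^ P.d * ((P.L : ℝ) ^ 2)⁻¹) ^ D.k * ∑ p : Plaq P D.k, curl 1 Bk p ^ 2 :=
        mul_le_mul_of_nonneg_left hL24 (by positivity)
    _ ≤ _ := hA

/-- ★★★ **(2.153), LOCAL TREE FORM AND V1 `Q`**: `B̂` gauged on the blocks of `S ⊂ T^{(k+1)}` and vanishing inside the others («We put B = 0 outside Λ»),
`(QB̂)(c) = 0` for every `c : PBond P (k+1)` (`k + 1 ≤ m + K`). [cite: Balaban1984PropagatorsII, (2.153) p.249, Lemma 2.4 (2.128) p.245; Balaban1984PropagatorsI, (1.11) p.19] -/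
theorem ineq2153_multiLevel_bondAvg (hd : 2 ≤ P.d) (hk1 : D.k + 1 ≤ P.m + P.K) {c : ℝ} (hc : c ≠ 0) {w : BondIdx D → ℝ}
    (hw : ∀ i, 0 < w i) (B : BondIdxSpace D) (hB : ∀ i : BondIdx D, (i.1.1 : ℕ) < D.k → B i = 0) (Bk : PBond P D.k → ℝ)
    (hBk : ∀ (b : PBond P D.k) (h : D.LamBond D.k b), Bk b = B ⟨⟨Fin.last D.k, b⟩, h⟩)
    (hBk0 : ∀ b : PBond P D.k, ¬ D.LamBond D.k b → Bk b = 0) (S : Set (Site P (D.k + 1)))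
    (hT : ∀ y ∈ S, ∀ b ∈ treeBonds P.L (cornerLab y), Bk ⟨zcast D.k b.1, b.2⟩ = 0)
    (hoff : ∀ y, y ∉ S → ∀ b : PBond P D.k, blockOf b.src = y → blockOf b.tgt = y → Bk b = 0)
    (hQ : ∀ c' : PBond P (D.k + 1), bondAvg Bk c' = 0) :
    c ^ 2 * ((P.L : ℝ) ^ P.d * ((P.L : ℝ) ^ 2)⁻¹) ^ D.k * (1 / (12 * (P.d : ℝ) ^ 2) * ((P.L : ℝ) ^ (P.d + 1))⁻¹) * ‖B‖ ^ 2 ≤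
      ⟪B, EE D hc hw B⟫_ℝ - ∑ i, w i * B i ^ 2 := by
  have hA := ineq2118_lower_multiLevel D hc hw B hB Bk hBk hBk0
  have hL24 := lemma24_topTorus_local hd hk1 Bk S hT hoff
  have h0 : ∑ c' : PBond P (D.k + 1), bondAvg Bk c' ^ 2 = 0 :=
    Finset.sum_eq_zero fun c' _ => by rw [hQ c', zero_pow two_ne_zero]
  rw [h0, mul_zero, zero_add] at hL24
  have hL : (0 : ℝ) < P.L := Nat.cast_pos.mpr P.L_pos
  rw [normSq_eq_sum_sq_top D B hB Bk hBk hBk0]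
  calc c ^ 2 * ((P.L : ℝ) ^ P.d * ((P.L : ℝ) ^ 2)⁻¹) ^ D.k * (1 / (12 * (P.d : ℝ) ^ 2) * ((P.L : ℝ) ^ (P.d + 1))⁻¹) *
        ∑ b : PBond P D.k, Bk b ^ 2
      = c ^ 2 * ((P.L : ℝ) ^ P.d * ((P.L : ℝ) ^ 2)⁻¹) ^ D.k *
          (1 / (12 * (P.d : ℝ) ^ 2) * ((P.L : ℝ) ^ (P.d + 1))⁻¹ * ∑ b : PBond P D.k, Bk b ^ 2) := by ring
    _ ≤ c ^ 2 * ((P.L : ℝ) ^ P.d * ((P.L : ℝ) ^ 2)⁻¹) ^ D.k * ∑ p : Plaq P D.k, curl 1 Bk p ^ 2 :=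
        mul_le_mul_of_nonneg_left hL24 (by positivity)
    _ ≤ _ := hA

/-! ## §3 The same in the currency of real bond FUNCTIONS on `𝔅` (the scalar row the NODE-00 lift consumes) -/

/-- the form of `(QGQ*)⁻¹ − a` on a real bond function read as an element of `L²(𝔅)`: `⟨g,(QGQ*)⁻¹g⟩ − Σ w·g² = Σ_q g(q)·(((QGQ*)⁻¹g)(q) − w(q)g(q))`.
[cite: Balaban1984PropagatorsII, (2.18)–(2.20) p.226, (2.35) p.228, bookkeeping] -/
theorem inner_EE_toLp_eq_sum {c : ℝ} (hc : c ≠ 0) {w : BondIdx D → ℝ} (hw : ∀ i, 0 < w i) (g : BondIdx D → ℝ) :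
    ⟪(WithLp.toLp 2 g : BondIdxSpace D), EE D hc hw (WithLp.toLp 2 g)⟫_ℝ - ∑ i, w i * (WithLp.toLp 2 g : BondIdxSpace D) i ^ 2 =
      ∑ i, g i * (EE D hc hw (WithLp.toLp 2 g) i - w i * g i) := by
  rw [inner_eq_sum, ← Finset.sum_sub_distrib]
  refine Finset.sum_congr rfl fun i _ => ?_
  show g i * _ - w i * g i ^ 2 = _
  ring

/-- ★★★ **(2.153) FOR REAL BOND FUNCTIONS `g : 𝔅 → ℝ`** (the scalar row of NODE 00's lift; `onFun (EE …) g = EE … (toLp g)` by `rfl`): same hypotheses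
as `ineq2153_multiLevel` on `g` and its top reading `ĝ`. [cite: Balaban1984PropagatorsII, (2.153) p.249; Balaban1985BackgroundPropagators, (3.156) p.428] -/
theorem ineq2153_multiLevel_fun (hd : 2 ≤ P.d) (hLM : P.L ∣ P.sitesPerDir D.k) {c : ℝ} (hc : c ≠ 0) {w : BondIdx D → ℝ}
    (hw : ∀ i, 0 < w i) (g : BondIdx D → ℝ) (hg : ∀ i : BondIdx D, (i.1.1 : ℕ) < D.k → g i = 0) (gk : PBond P D.k → ℝ)
    (hgk : ∀ (b : PBond P D.k) (h : D.LamBond D.k b), gk b = g ⟨⟨Fin.last D.k, b⟩, h⟩)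
    (hgk0 : ∀ b : PBond P D.k, ¬ D.LamBond D.k b → gk b = 0)
    (hT : ∀ y ∈ coarseSites P.L (periodAt P D.k), ∀ b ∈ treeBonds P.L y, gk ⟨zcast D.k b.1, b.2⟩ = 0)
    (hQ : ∀ c' ∈ faces P.L (periodAt P D.k), B6Lemma24PrintedShape.q1 P.L (zlift gk) c' = 0) :
    c ^ 2 * ((P.L : ℝ) ^ P.d * ((P.L : ℝ) ^ 2)⁻¹) ^ D.k * (1 / (12 * (P.d : ℝ) ^ 2) * ((P.L : ℝ) ^ (P.d + 1))⁻¹) * ∑ i, g i ^ 2 ≤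
      ∑ i, g i * (EE D hc hw (WithLp.toLp 2 g) i - w i * g i) := by
  have h := ineq2153_multiLevel D hd hLM hc hw (WithLp.toLp 2 g) (fun i hi => by simp [hg i hi]) gk
    (fun b hb => by rw [hgk b hb, WithLp.ofLp_toLp]) hgk0 hT hQ
  rwa [inner_EE_toLp_eq_sum, normSq_eq_sum_sq] at h

/-- ★★★ **(2.153) FOR REAL BOND FUNCTIONS, LOCAL TREE FORM AND V1 `Q`**. [cite: Balaban1984PropagatorsII, (2.153) p.249, Lemma 2.4 (2.128) p.245] -/
theorem ineq2153_multiLevel_fun_bondAvg (hd : 2 ≤ P.d) (hk1 : D.k + 1 ≤ P.m + P.K) {c : ℝ} (hc : c ≠ 0) {w : BondIdx D → ℝ}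
    (hw : ∀ i, 0 < w i) (g : BondIdx D → ℝ) (hg : ∀ i : BondIdx D, (i.1.1 : ℕ) < D.k → g i = 0) (gk : PBond P D.k → ℝ)
    (hgk : ∀ (b : PBond P D.k) (h : D.LamBond D.k b), gk b = g ⟨⟨Fin.last D.k, b⟩, h⟩)
    (hgk0 : ∀ b : PBond P D.k, ¬ D.LamBond D.k b → gk b = 0) (S : Set (Site P (D.k + 1)))
    (hT : ∀ y ∈ S, ∀ b ∈ treeBonds P.L (cornerLab y), gk ⟨zcast D.k b.1, b.2⟩ = 0)
    (hoff : ∀ y, y ∉ S → ∀ b : PBond P D.k, blockOf b.src = y → blockOf b.tgt = y → gk b = 0)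
    (hQ : ∀ c' : PBond P (D.k + 1), bondAvg gk c' = 0) :
    c ^ 2 * ((P.L : ℝ) ^ P.d * ((P.L : ℝ) ^ 2)⁻¹) ^ D.k * (1 / (12 * (P.d : ℝ) ^ 2) * ((P.L : ℝ) ^ (P.d + 1))⁻¹) * ∑ i, g i ^ 2 ≤
      ∑ i, g i * (EE D hc hw (WithLp.toLp 2 g) i - w i * g i) := by
  have h := ineq2153_multiLevel_bondAvg D hd hk1 hc hw (WithLp.toLp 2 g) (fun i hi => by simp [hg i hi]) gk
    (fun b hb => by rw [hgk b hb, WithLp.ofLp_toLp]) hgk0 S hT hoff hQ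
  rwa [inner_EE_toLp_eq_sum, normSq_eq_sum_sq] at h

/-! ## §4 Print's units: with `c = Lᵏ = η⁻¹` the constant is `η^{−(d+1)}·(1∕(12d²))·L^{−(d+1)}` -/

/-- the constant at `c = Lᵏ`: `(Lᵏ)²·(L^d∕L²)^k·γ = L^{kd}·γ`. [cite: Balaban1984PropagatorsII, (2.153) p.249; Balaban1984PropagatorsI, (1.18) p.20 («η = L^{−k}»), bookkeeping] -/
theorem const_eq_of_cf (k : ℕ) :
    ((P.L : ℝ) ^ k) ^ 2 * ((P.L : ℝ) ^ P.d * ((P.L : ℝ) ^ 2)⁻¹) ^ k * (1 / (12 * (P.d : ℝ) ^ 2) * ((P.L : ℝ) ^ (P.d + 1))⁻¹) =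
      (((P.L : ℝ) ^ k) ^ P.d) * (1 / (12 * (P.d : ℝ) ^ 2) * ((P.L : ℝ) ^ (P.d + 1))⁻¹) := by
  have hL : (P.L : ℝ) ≠ 0 := Nat.cast_ne_zero.mpr P.L_pos.ne'
  congr 1
  rw [mul_pow, inv_pow, ← pow_mul, ← pow_mul, ← pow_mul, ← pow_mul]
  field_simp
  ring

/-- ★★★ **(2.153) IN PRINT's UNITS** (`c = Lᵏ = η⁻¹`): `(1∕(12d²))·(L^{d+1})⁻¹·Σ g² ≤ (L^{kd})⁻¹·Σ_q g·((QGQ*)⁻¹g − w·g)` — the right factor is def-Y's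
`etaDY` at NODE 00 (`(d−1)+1 = d` = `P.d`), so the constant `(1∕(12d²))·L^{−(d+1)}` is MEMBER-UNIFORM («independent of k»).
[cite: Balaban1984PropagatorsII, (2.153) p.249; Balaban1985BackgroundPropagators, (3.156) p.428 + p.428 («γ₀ > 0 independent of k and U»)] -/
theorem ineq2153_multiLevel_fun_printUnits (hd : 2 ≤ P.d) (hLM : P.L ∣ P.sitesPerDir D.k) {c : ℝ} (hcL : c = (P.L : ℝ) ^ D.k)
    (hc : c ≠ 0) {w : BondIdx D → ℝ}
    (hw : ∀ i, 0 < w i) (g : BondIdx D → ℝ) (hg : ∀ i : BondIdx D, (i.1.1 : ℕ) < D.k → g i = 0) (gk : PBond P D.k → ℝ)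
    (hgk : ∀ (b : PBond P D.k) (h : D.LamBond D.k b), gk b = g ⟨⟨Fin.last D.k, b⟩, h⟩)
    (hgk0 : ∀ b : PBond P D.k, ¬ D.LamBond D.k b → gk b = 0)
    (hT : ∀ y ∈ coarseSites P.L (periodAt P D.k), ∀ b ∈ treeBonds P.L y, gk ⟨zcast D.k b.1, b.2⟩ = 0)
    (hQ : ∀ c' ∈ faces P.L (periodAt P D.k), B6Lemma24PrintedShape.q1 P.L (zlift gk) c' = 0) :
    (1 / (12 * (P.d : ℝ) ^ 2) * ((P.L : ℝ) ^ (P.d + 1))⁻¹) * ∑ i, g i ^ 2 ≤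
      (((P.L : ℝ) ^ D.k) ^ P.d)⁻¹ * ∑ i, g i * (EE D hc hw (WithLp.toLp 2 g) i - w i * g i) := by
  have h := ineq2153_multiLevel_fun D hd hLM hc hw g hg gk hgk hgk0 hT hQ
  subst hcL
  rw [const_eq_of_cf D.k] at h
  have hL : (0 : ℝ) < P.L := Nat.cast_pos.mpr P.L_pos
  have hη : (0 : ℝ) < ((P.L : ℝ) ^ D.k) ^ P.d := by positivity
  rw [mul_assoc] at h
  exact (le_inv_mul_iff₀ hη).mpr h

end

end Literature.MathematicalPhysics.QuantumFieldTheory.Balaban1983to89.B6Ineq2153MultiLevelV1
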